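import Mathlib
import Literature.NumberTheory.Sieve.BombieriVinogradovMoebiusIntervals
import Summits.Parity.BatemanHorn.Theorems.PolynomialMobiusPolyMobiusTailStubPairCornerClasses
import Summits.Parity.BatemanHorn.Theorems.PolynomialMobiusPolyMobiusTailStubPairCornerIdentity
import HarnessLib

/-!
# Crux `PolyMobiusTail` (stmt-Parity-0870), line `eta-free-multilinear-window`:
# helper for `stub_pair_corner` — the one-sided corner is `O(x / log x)`

Aux stub `stub_pair_corner_mainBound`: for linear forms `P(n) = q₀ n + a₀`, `R(n) = q₁ n + a₁`
(`q₀, q₁ ≥ 1`, `gcd(q₁, a₁) = 1`, `Δ = q₁ a₀ - q₀ a₁ ≠ 0`) and `σ, η > 0` with `3σ + η < 1`,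

  `∑_{n₁ ≤ n ≤ x} ∑_{d ∣ P(n)} ∑_{b ∣ R(n)} 𝟙[x^{1-η} < d b ≤ x^{1+θ}, d ≤ x^σ] μ(d) log d μ(b) log b ≤ K x / log x`

for `x ≥ x₁` (`n₁ = |a₀| + |a₁| + 1`).  Proof: the switched identity
(`stub_pair_corner_identity`); for each cofactor `m ≤ M ≤ R(x) x^{σ+η-1}` the `d`-sum is bounded by the
Bombieri–Vinogradov theorem for `μ` over the dilated moduli `q₁ d`, `d ≤ x^σ`
(`Literature.NumberTheory.Sieve.BVMoebius.sum_abs_moebiusAPSum_dilate_le`, saving `(log Y)^{-4}`) at the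
height `Y = R(x)/m ≥ x^{1-σ-η}` — the level condition `q₁ x^σ ≤ Y^{1/2} (log Y)^{-B}` holds eventually iff
`3σ + η < 1` — through `PairCorner.sum_abs_switched_le`; finally `∑_{m ≤ M} R(x)/m ≤ R(x)(1 + log M)` and
`R(x) ≤ 2 q₁ x`, for a total `≪ x (log x)^{3-4}`.
-/


open scoped BigOperators
open Filter Finset Asymptotics

namespace Summit.Parity.BatemanHorn.Theorems.PolyMobiusTail.EtaFreeWindow

open Literature.NumberTheory.Sieve


-- one long `calc` over the switched triple sum; the default budget is marginally too small
set_option maxHeartbeats 400000 in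
/-- **Aux stub `stub_pair_corner_mainBound` (helper for `stub_pair_corner`, line eta-free-multilinear-window):
the one-sided corner is `O(x / log x)`.**  For linear forms `P(n) = q₀ n + a₀`, `R(n) = q₁ n + a₁`
(`q₀, q₁ ≥ 1`, `gcd(q₁, a₁) = 1`, `Δ = q₁ a₀ - q₀ a₁ ≠ 0`) and exponents `σ, η > 0` with
`3σ + η < 1`, the corner sum `∑_{n₁ ≤ n ≤ x} ∑_{d ∣ P(n), d ≤ x^σ} ∑_{b ∣ R(n), x^{1-η} < d b ≤ x^{1+θ}}
μ(d) log d · μ(b) log b` (`n₁ = |a₀| + |a₁| + 1`) is `≤ K x / log x` for large `x`: after the switch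
(`stub_pair_corner_identity`) each cofactor `m ≤ M ≍ x^{σ+η}` costs, by `stub_pair_corner_classes` and the
Bombieri–Vinogradov theorem for `μ` over the moduli `q₁ d`, `d ≤ x^σ` at `Y = R(x)/m ≥ x^{1-σ-η}`
(level `x^σ ≤ Y^{1/2}(log Y)^{-B}` iff `3σ + η < 1`), `≪ log² x · Y (log Y)^{-4}`, and
`∑_{m ≤ M} Y = R(x) ∑ 1/m ≪ x log x`. [folklore] -/
theorem stub_pair_corner_mainBound : ∀ (q₀ q₁ : ℕ) (a₀ a₁ : ℤ), 0 < q₀ → 0 < q₁ →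
    Int.gcd (q₁ : ℤ) a₁ = 1 → (q₁ : ℤ) * a₀ - (q₀ : ℤ) * a₁ ≠ 0 → ∀ (σ η θ : ℝ), 0 < σ → 0 < η →
    3 * σ + η < 1 → ∃ K x₁ : ℝ, ∀ x : ℕ, x₁ ≤ (x : ℝ) →
      |∑ n ∈ Finset.Icc (a₀.natAbs + a₁.natAbs + 1) x, ∑ d ∈ (((q₀ : ℤ) * n + a₀).toNat).divisors,
          ∑ b ∈ (((q₁ : ℤ) * n + a₁).toNat).divisors, (if ((x : ℝ) ^ (1 - η) < (d : ℝ) * (b : ℝ) ∧ (d : ℝ) * (b : ℝ) ≤ (x : ℝ) ^ (1 + θ) ∧ (d : ℝ) ≤ (x : ℝ) ^ σ) then (ArithmeticFunction.moebius d : ℝ) * Real.log d * ((ArithmeticFunction.moebius b : ℝ) * Real.log b) else 0)| ≤ K * (x : ℝ) / Real.log x := by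
  intro q₀ q₁ a₀ a₁ hq₀ hq₁ hcop hΔ σ η θ hσ hη h3
  set n₁ : ℕ := (a₀.natAbs + a₁.natAbs + 1) with hn₁def
  set s : ℕ := ((q₁ : ℤ) * a₀ - (q₀ : ℤ) * a₁).natAbs with hsdef
  have hn₁ : 1 ≤ n₁ := by omega
  have habs₀ : -a₀ ≤ (a₀.natAbs : ℤ) := by rw [Int.natCast_natAbs]; exact neg_le_abs a₀
  have habs₁ : -a₁ ≤ (a₁.natAbs : ℤ) := by rw [Int.natCast_natAbs]; exact neg_le_abs a₁
  have hn₁z : (n₁ : ℤ) = a₀.natAbs + a₁.natAbs + 1 := by rw [hn₁def]; push_cast; ring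
  have hP : 0 < (q₀ : ℤ) * n₁ + a₀ := by
    have h1 : (n₁ : ℤ) ≤ (q₀ : ℤ) * n₁ := le_mul_of_one_le_left (by positivity) (by exact_mod_cast hq₀)
    linarith
  have hR : 0 < (q₁ : ℤ) * n₁ + a₁ := by
    have h1 : (n₁ : ℤ) ≤ (q₁ : ℤ) * n₁ := le_mul_of_one_le_left (by positivity) (by exact_mod_cast hq₁)
    linarith
  set δ : ℝ := 1 - σ - η with hδdef
  have hδ : 0 < δ := by rw [hδdef]; linarith
  set κ : ℝ := (δ / 2 - σ) / 2 with hκdef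
  have hκ : 0 < κ := by rw [hκdef, hδdef]; linarith
  obtain ⟨B, C, x₀, hB, hC, hBV⟩ := BVMoebius.sum_abs_moebiusAPSum_dilate_le 4 (by norm_num)
  -- the eventual side conditions, in a real variable
  have hq₁r : (1 : ℝ) ≤ q₁ := by exact_mod_cast hq₁
  have hev : ∀ᶠ y : ℝ in atTop, (n₁ : ℝ) ≤ y ∧ 3 ≤ y ∧ (a₁ : ℝ) ≤ y ∧ 2 * (q₁ : ℝ) ≤ y ∧
      2 * (q₁ : ℝ) ≤ y ^ δ ∧ x₀ ≤ y ^ δ ∧ 3 ≤ y ^ δ ∧ Real.log y ^ B ≤ y ^ κ ∧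
      (q₁ : ℝ) * 2 ^ B ≤ y ^ κ := by
    filter_upwards [eventually_ge_atTop (n₁ : ℝ), eventually_ge_atTop (3 : ℝ),
      eventually_ge_atTop (a₁ : ℝ), eventually_ge_atTop (2 * (q₁ : ℝ)),
      (tendsto_rpow_atTop hδ).eventually_ge_atTop (2 * (q₁ : ℝ)),
      (tendsto_rpow_atTop hδ).eventually_ge_atTop x₀,
      (tendsto_rpow_atTop hδ).eventually_ge_atTop 3,
      Literature.NumberTheory.Sieve.eventually_log_rpow_le_rpow B hκ,
      (tendsto_rpow_atTop hκ).eventually_ge_atTop ((q₁ : ℝ) * 2 ^ B)] with y h1 h2 h3 h4 h5 h6 h7 h8 h9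
    exact ⟨h1, h2, h3, h4, h5, h6, h7, h8, h9⟩
  obtain ⟨x₁, hx₁⟩ := Filter.eventually_atTop.1 hev
  refine ⟨16 * (s : ℝ) ^ 2 * C * q₁ / δ ^ 4, x₁, fun x hx => ?_⟩
  obtain ⟨hxn₁r, hx3, hxa₁, hx2q, hx2qδ, hx₀δ, hx3δ, hlogB, hq2B⟩ := hx₁ x hx
  have hxn₁ : n₁ ≤ x := by exact_mod_cast hxn₁r
  have hx0 : (0 : ℝ) < x := by linarith
  have hx1 : (1 : ℝ) < x := by linarith
  have hlogx1 : 1 ≤ Real.log x := by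
    rw [Real.le_log_iff_exp_le hx0]
    exact (Real.exp_one_lt_d9.le.trans (by norm_num)).trans hx3
  have hlogx0 : 0 < Real.log x := by linarith
  set Rxr : ℝ := (q₁ : ℝ) * x + a₁ with hRxrdef
  have hRxz : 0 < (q₁ : ℤ) * x + a₁ := by
    have : (q₁ : ℤ) * n₁ ≤ (q₁ : ℤ) * x :=
      mul_le_mul_of_nonneg_left (by exact_mod_cast hxn₁) (by positivity)
    linarith
  have hRxr0 : 0 < Rxr := by have := hRxz; rw [hRxrdef]; exact_mod_cast this
  have hRx2 : Rxr ≤ 2 * (q₁ : ℝ) * x := by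
    have h1 : (x : ℝ) ≤ (q₁ : ℝ) * x := le_mul_of_one_le_left hx0.le hq₁r
    rw [hRxrdef]; linarith
  have hx2qx : 2 * (q₁ : ℝ) * x ≤ x * x := mul_le_mul_of_nonneg_right hx2q hx0.le
  have hlogRx : Real.log Rxr ≤ 2 * Real.log x := by
    calc Real.log Rxr ≤ Real.log (x * x) := Real.log_le_log hRxr0 (hRx2.trans hx2qx)
      _ = 2 * Real.log x := by rw [Real.log_mul hx0.ne' hx0.ne']; ring
  have hlogRx0 : 0 ≤ Real.log Rxr := by
    refine Real.log_nonneg ?_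
    have : (1 : ℤ) ≤ (q₁ : ℤ) * x + a₁ := hRxz
    rw [hRxrdef]; exact_mod_cast this
  have hBxr : (((((q₁ : ℤ) * x + a₁).toNat : ℕ) : ℝ)) = Rxr := by
    have : (((((q₁ : ℤ) * x + a₁).toNat : ℕ) : ℤ)) = (q₁ : ℤ) * x + a₁ := Int.toNat_of_nonneg hRxz.le
    rw [hRxrdef]; exact_mod_cast this
  -- `M` and `D`
  set M : ℕ := ⌊((q₁ : ℝ) * x + a₁) * (x : ℝ) ^ (σ + η - 1)⌋₊ with hMdef
  set D : ℕ := ⌊(x : ℝ) ^ σ⌋₊ with hDdef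
  have hxδ : (x : ℝ) ^ (σ + η - 1) = ((x : ℝ) ^ δ)⁻¹ := by
    rw [← Real.rpow_neg hx0.le, hδdef]; ring_nf
  have hxδ0 : 0 < (x : ℝ) ^ δ := Real.rpow_pos_of_pos hx0 δ
  have hMle : (M : ℝ) ≤ Rxr / (x : ℝ) ^ δ := by
    calc (M : ℝ) ≤ Rxr * (x : ℝ) ^ (σ + η - 1) :=
          Nat.floor_le (show 0 ≤ Rxr * (x : ℝ) ^ (σ + η - 1) by positivity)
      _ = Rxr / (x : ℝ) ^ δ := by rw [hxδ, div_eq_mul_inv]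
  have hMx : (M : ℝ) ≤ x := by
    refine hMle.trans ?_
    rw [div_le_iff₀ hxδ0]
    have h1 : 2 * (q₁ : ℝ) * x ≤ (x : ℝ) ^ δ * x := mul_le_mul_of_nonneg_right hx2qδ hx0.le
    linarith
  have hlogM : Real.log M ≤ Real.log x := by
    rcases Nat.eq_zero_or_pos M with h | h
    · rw [h, Nat.cast_zero, Real.log_zero]; exact hlogx0.le
    · exact Real.log_le_log (by exact_mod_cast h) hMx
  -- facts about `d ≤ D`
  have hD : ∀ d ∈ Finset.Icc 1 D, Real.log d ≤ Real.log x ∧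
      ((q₁ * d : ℕ) : ℝ) ≤ (x : ℝ) ^ (δ / 2) / (2 * Real.log x) ^ B := by
    intro d hd
    obtain ⟨hd1, hdD⟩ := Finset.mem_Icc.1 hd
    have hd1r : (1 : ℝ) ≤ d := by exact_mod_cast hd1
    have hdσ : (d : ℝ) ≤ (x : ℝ) ^ σ :=
      le_trans (by exact_mod_cast hdD) (Nat.floor_le (Real.rpow_nonneg hx0.le σ))
    have hσx : (x : ℝ) ^ σ ≤ x := by
      calc (x : ℝ) ^ σ ≤ (x : ℝ) ^ (1 : ℝ) :=
            Real.rpow_le_rpow_of_exponent_le hx1.le (by linarith)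
        _ = x := Real.rpow_one _
    refine ⟨Real.log_le_log (by linarith) (hdσ.trans hσx), ?_⟩
    have h2log : 0 < (2 * Real.log x) ^ B := Real.rpow_pos_of_pos (by linarith) B
    rw [le_div_iff₀ h2log, Real.mul_rpow (by norm_num) hlogx0.le]
    push_cast
    calc (q₁ : ℝ) * d * (2 ^ B * Real.log x ^ B) = ((q₁ : ℝ) * 2 ^ B) * Real.log x ^ B * d := by ring
      _ ≤ (x : ℝ) ^ κ * (x : ℝ) ^ κ * (x : ℝ) ^ σ := by
          refine mul_le_mul (mul_le_mul hq2B hlogB (Real.rpow_nonneg hlogx0.le B)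
            (Real.rpow_nonneg hx0.le κ)) hdσ (by positivity) (by positivity)
      _ = (x : ℝ) ^ (δ / 2) := by
          rw [← Real.rpow_add hx0, ← Real.rpow_add hx0, hκdef]; ring_nf
  -- the switched identity
  rw [stub_pair_corner_identity q₀ q₁ a₀ a₁ hq₁ n₁ hn₁ hP hR σ η θ x hxn₁]
  -- the bound, cofactor by cofactor
  have hm : ∀ m ∈ Finset.Icc 1 M,
      ∑ d ∈ Finset.Icc 1 D, |(ArithmeticFunction.moebius d : ℝ) * Real.log d *
        ∑ b ∈ (Finset.Icc 1 ((q₁ : ℤ) * x + a₁).toNat).filter (fun b : ℕ => ((x : ℝ) ^ (1 - η) < (d : ℝ) * (b : ℝ) ∧ (d : ℝ) * (b : ℝ) ≤ (x : ℝ) ^ (1 + θ) ∧ (d : ℝ) ≤ (x : ℝ) ^ σ) ∧ ∃ n ∈ Finset.Icc n₁ x, d ∣ ((q₀ : ℤ) * n + a₀).toNat ∧ b * m = ((q₁ : ℤ) * n + a₁).toNat), (ArithmeticFunction.moebius b : ℝ) * Real.log b| ≤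
      Real.log x * (2 * (s : ℝ) ^ 2 * Real.log Rxr) * (C * (Rxr / m) / Real.log (Rxr / m) ^ (4 : ℝ)) := by
    intro m hmM
    obtain ⟨hm1, hmM⟩ := Finset.mem_Icc.1 hmM
    have hm0 : (0 : ℝ) < m := by exact_mod_cast hm1
    have hM0 : (0 : ℝ) < M := by exact_mod_cast lt_of_lt_of_le hm1 hmM
    -- `Y = R(x)/m ≥ x^δ`
    have hYδ : (x : ℝ) ^ δ ≤ Rxr / m := by
      rw [le_div_iff₀ hm0]
      have h1 : (m : ℝ) * (x : ℝ) ^ δ ≤ M * (x : ℝ) ^ δ :=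
        mul_le_mul_of_nonneg_right (by exact_mod_cast hmM) hxδ0.le
      have h2 : (M : ℝ) * (x : ℝ) ^ δ ≤ Rxr := by rwa [le_div_iff₀ hxδ0] at hMle
      linarith
    have hY1 : 1 < Rxr / m := by linarith
    have hYR : Rxr / m ≤ Rxr := div_le_self hRxr0.le (by exact_mod_cast hm1)
    have hlogY0 : 0 < Real.log (Rxr / m) := Real.log_pos hY1
    have hlogY : Real.log (Rxr / m) ≤ 2 * Real.log x :=
      (Real.log_le_log (by linarith) hYR).trans hlogRx
    refine PairCorner.sum_abs_switched_le hq₁ hcop hΔ hP hR σ η θ hxn₁ hm1 (fun d hd => (hD d hd).1)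
      hBV (hx₀δ.trans hYδ) ?_ (fun d hd => (hD d hd).2.trans ?_)
    · calc (((((q₁ : ℤ) * x + a₁).toNat / m : ℕ) : ℝ)) ≤ ((((q₁ : ℤ) * x + a₁).toNat : ℕ) : ℝ) / m := Nat.cast_div_le
        _ = Rxr / m := by rw [hBxr]
    · have hnum : (x : ℝ) ^ (δ / 2) ≤ (Rxr / m) ^ (1 / 2 : ℝ) := by
        calc (x : ℝ) ^ (δ / 2) = ((x : ℝ) ^ δ) ^ (1 / 2 : ℝ) := by
              rw [← Real.rpow_mul hx0.le]; ring_nf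
          _ ≤ (Rxr / m) ^ (1 / 2 : ℝ) := Real.rpow_le_rpow hxδ0.le hYδ (by norm_num)
      have hden : Real.log (Rxr / m) ^ B ≤ (2 * Real.log x) ^ B :=
        Real.rpow_le_rpow hlogY0.le hlogY hB.le
      exact div_le_div₀ (Real.rpow_nonneg (by positivity) _) hnum
        (Real.rpow_pos_of_pos hlogY0 B) hden
  have h4 : ∀ m ∈ Finset.Icc 1 M, (δ * Real.log x) ^ (4 : ℕ) ≤ Real.log (Rxr / m) ^ (4 : ℝ) := by
    intro m hmM
    obtain ⟨hm1, hmM⟩ := Finset.mem_Icc.1 hmM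
    have hm0 : (0 : ℝ) < m := by exact_mod_cast hm1
    have hYδ : (x : ℝ) ^ δ ≤ Rxr / m := by
      rw [le_div_iff₀ hm0]
      have h1 : (m : ℝ) * (x : ℝ) ^ δ ≤ M * (x : ℝ) ^ δ :=
        mul_le_mul_of_nonneg_right (by exact_mod_cast hmM) hxδ0.le
      have h2 : (M : ℝ) * (x : ℝ) ^ δ ≤ Rxr := by rwa [le_div_iff₀ hxδ0] at hMle
      linarith
    have hlo : δ * Real.log x ≤ Real.log (Rxr / m) := by
      rw [← Real.log_rpow hx0]
      exact Real.log_le_log hxδ0 hYδ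
    rw [show ((4 : ℝ)) = ((4 : ℕ) : ℝ) by norm_num, Real.rpow_natCast]
    exact pow_le_pow_left₀ (by positivity) hlo 4
  have hδlog : 0 < (δ * Real.log x) ^ (4 : ℕ) := by positivity
  calc |∑ m ∈ Finset.Icc 1 M, ∑ d ∈ Finset.Icc 1 D, (ArithmeticFunction.moebius d : ℝ) * Real.log d *
          ∑ b ∈ (Finset.Icc 1 ((q₁ : ℤ) * x + a₁).toNat).filter (fun b : ℕ => ((x : ℝ) ^ (1 - η) < (d : ℝ) * (b : ℝ) ∧ (d : ℝ) * (b : ℝ) ≤ (x : ℝ) ^ (1 + θ) ∧ (d : ℝ) ≤ (x : ℝ) ^ σ) ∧ ∃ n ∈ Finset.Icc n₁ x, d ∣ ((q₀ : ℤ) * n + a₀).toNat ∧ b * m = ((q₁ : ℤ) * n + a₁).toNat), (ArithmeticFunction.moebius b : ℝ) * Real.log b|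
      ≤ ∑ m ∈ Finset.Icc 1 M, ∑ d ∈ Finset.Icc 1 D, |(ArithmeticFunction.moebius d : ℝ) * Real.log d *
          ∑ b ∈ (Finset.Icc 1 ((q₁ : ℤ) * x + a₁).toNat).filter (fun b : ℕ => ((x : ℝ) ^ (1 - η) < (d : ℝ) * (b : ℝ) ∧ (d : ℝ) * (b : ℝ) ≤ (x : ℝ) ^ (1 + θ) ∧ (d : ℝ) ≤ (x : ℝ) ^ σ) ∧ ∃ n ∈ Finset.Icc n₁ x, d ∣ ((q₀ : ℤ) * n + a₀).toNat ∧ b * m = ((q₁ : ℤ) * n + a₁).toNat), (ArithmeticFunction.moebius b : ℝ) * Real.log b| :=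
        (Finset.abs_sum_le_sum_abs _ _).trans (Finset.sum_le_sum fun m _ => Finset.abs_sum_le_sum_abs _ _)
    _ ≤ ∑ m ∈ Finset.Icc 1 M, Real.log x * (2 * (s : ℝ) ^ 2 * Real.log Rxr) *
          (C * (Rxr / m) / Real.log (Rxr / m) ^ (4 : ℝ)) := Finset.sum_le_sum hm
    _ ≤ ∑ m ∈ Finset.Icc 1 M, Real.log x * (2 * (s : ℝ) ^ 2 * (2 * Real.log x)) *
          (C * (Rxr / m) / (δ * Real.log x) ^ (4 : ℕ)) := by
        refine Finset.sum_le_sum fun m hmM => ?_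
        have hm0 : (0 : ℝ) < m := by exact_mod_cast (Finset.mem_Icc.1 hmM).1
        refine mul_le_mul (mul_le_mul_of_nonneg_left
          (mul_le_mul_of_nonneg_left hlogRx (by positivity)) hlogx0.le) ?_ ?_ ?_
        · exact div_le_div_of_nonneg_left (by positivity) hδlog (h4 m hmM)
        · have : 0 < Real.log (Rxr / m) ^ (4 : ℝ) := lt_of_lt_of_le hδlog (h4 m hmM)
          positivity
        · positivity
    _ = Real.log x * (4 * (s : ℝ) ^ 2 * Real.log x) * C * Rxr / (δ * Real.log x) ^ (4 : ℕ) *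
          ∑ m ∈ Finset.Icc 1 M, ((m : ℝ))⁻¹ := by
        rw [Finset.mul_sum]
        refine Finset.sum_congr rfl fun m _ => ?_
        ring
    _ ≤ Real.log x * (4 * (s : ℝ) ^ 2 * Real.log x) * C * Rxr / (δ * Real.log x) ^ (4 : ℕ) *
          (1 + Real.log M) :=
        mul_le_mul_of_nonneg_left (Literature.NumberTheory.Sieve.harmonic_Icc_le M) (by positivity)
    _ ≤ Real.log x * (4 * (s : ℝ) ^ 2 * Real.log x) * C * (2 * (q₁ : ℝ) * x) / (δ * Real.log x) ^ (4 : ℕ) *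
          (2 * Real.log x) := by
        have hlogM' : 1 + Real.log M ≤ 2 * Real.log x := by linarith
        have hlogM0 : 0 ≤ 1 + Real.log M := by
          have := Real.log_natCast_nonneg M; linarith
        refine mul_le_mul ?_ hlogM' hlogM0 (by positivity)
        exact div_le_div_of_nonneg_right (mul_le_mul_of_nonneg_left hRx2 (by positivity)) hδlog.le
    _ = 16 * (s : ℝ) ^ 2 * C * q₁ / δ ^ 4 * x / Real.log x := by
        field_simp
        ring

end Summit.Parity.BatemanHorn.Theorems.PolyMobiusTail.EtaFreeWindow
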